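import Literature.MathematicalPhysics.QuantumFieldTheory.Balaban1983to89.Node00.Record13NumericsOfThm1CCMWZB
import Literature.MathematicalPhysics.QuantumFieldTheory.Balaban1983to89.Node00.Record13NumericsOfThm1CCMZChi

/-!
# NODE 00 — OP 5a (dag-lead g40 HANDS-3 H3.1, director-ym №478): DEF-1's DOOR WITNESS `θ₁₅ᶜᶜᴹᵂᶻᴮ` IN THE χ SLOT — `theta13OfThm1CCMWZBChi j γ εbg ε₀ ε₂₉ B₃ B₃' a₀ a₁ Efl logz χ` —
# with ALL its faces (`rfl`), rows `HasResidualsOfRecord` ∕ Z ∕ G ∕ P12 ∕ N1 and the N09 regime letters, receipts at the record's own slot (`rfl`), and the re-centred instance OF THE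
# SAME ARITY AS THE BARE NAME `theta13OfThm1CCMWZBAx j γ εbg ε₀ ε₂₉ B₃ B₃' a₀ a₁ Efl logz` with every face and row again (χ-generic ∕ Ax edition of exactly the centred declarations of
# `Node00/Record13NumericsOfThm1CCMWZB` §2–§5 in dag-n07-w3 g22's σ-closure of the K0 V23 door, `SIGMA-CLOSURE-K0-V23-Ax.g22.md` 4ca252f7ab47910a; NEW names only, no body of record touched)

Cell `pub-ymgap`, seat `pub-ymgap-node00-def-Y` (g34; Node00 custodian ∕ definer), count-neutral.  [I] = [Balaban1987RG1], [III] = [Balaban1988Convergent],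
[IV] = [Balaban1989LargeFieldI], [V] = [Balaban1989LargeFieldII], [B11] = [Balaban1985Variational].  σ-recipe of [Ax-3b] `Node00/Record13Chi`; beneath: this seat's
`Record13LiveSelectorChi` (`liveRepin₁₃Chi`) and `Record13NumericsOfThm1CCMZChi` (`theta13LiveOfNumericsZChi ∕ …ZAx`).  The B numerics `stage12NumericsOfThm1CCMWB` and every
numerics face are centre-free and CITED (DEF-1's §1), not re-issued.

WHY (dag-n07-w3 g22 FINDING 1 + H3.3 ORDER OF PLAY, bus 2026-08-31T01:38Z).  V23's `θ := theta13OfThm1CCMWZB …` is `theta13LiveOfNumericsZ` at the B numerics, hence centred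
through the live re-pin; the Summits-side Ax editions of `…K0AllTorusOfStepTokensGuardedZBLam{,Print}` ∕ `…K0V23Defs` ∕ `…K0V23Stub3*Suppliers` (dag-n07-w3, H3.3) name
`theta13OfThm1CCMWZBAx` + its `rfl` faces `_ν ∕ _εreg ∕ _ε₀ ∕ _ε₂₉ ∕ _γ ∕ _εbg …`, and module #1 of H3.1 (this seat's `Record13LettersOfThm1CCMWZBChi`, DEF-1's 38 letters at the
χ ∕ Ax witness) stands on this file.  NAMING (so that H3.3's σ is a token map): χ-generic objects `…Chi … χ` with faces `…Chi_<field>`, χ-generic rows `<row>_chi`; re-centred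
objects and rows = the source name with the witness token `CCMWZB ↦ CCMWZBAx` (same arity as the bare name).

WHAT THIS FILE DECLARES (token for token against `Record13NumericsOfThm1CCMWZB` :128–:305; the three `rfl` bridges `theta13OfThm1CCM{WZ,W,Z}_eq_B` to OTHER landed witnesses and
`_ν_eq` are not re-issued — those witnesses have no χ edition and no V23 consumer):
* §1 `theta13OfThm1CCMWZBChi … χ := theta13LiveOfNumericsZChi F N (stage12NumericsOfThm1CCMWB …) ε₂₉ (zeta316OfRecord …) (RzOfRecord F N) (ZtOfRecord F N) Efl logz χ`, `_eq`, the
  faces `_εbg ∕ _Efl ∕ _logz ∕ _γ ∕ _ν ∕ _εreg ∕ _A₀ ∕ _M₁ ∕ _M₂ ∕ _p₀ ∕ _r ∕ _ε₀ ∕ _ε₂₉ ∕ _s2 ∕ _cB ∕ _B ∕ _C ∕ _Mr ∕ _cR ∕ _βc ∕ _κ ∕ _τ9_M ∕ _A₁ ∕ _Rz ∕ _ℓ₆_succ` (`rfl`),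
  rows N1 (`eight_le_L_… ∕ kp_tree_… ∕ kp_large_… ∕ kp_n10_…_chi`), `hasResidualsOfRecord_…_chi`, `ztUnity_…_chi`, row G `admissible_…_chi ∕ _of_le_half_chi ∕ _regime_chi`, ★ row P12
  `slotsNondegenerate₁₃_theta13OfThm1CCMWZB_chi` (HYPOTHESIS-FREE) ∕ `_of_provisos_chi`, regime letters `εbg_le_a₀_…_regime_chi ∕ εreg_le_εbg_…_regime_chi ∕ regimeLetters_…_chi`.
* §R receipts (`rfl` ∕ `Iff.rfl`): `theta13OfThm1CCMWZBChi_chiβ`, `theta13OfThm1CCMWZBChi_chiFixed29`, `slotsNondegenerate₁₃Chi_theta13OfThm1CCMWZBChi_chiβ_iff`.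
* §A `abbrev theta13OfThm1CCMWZBAx … := theta13LiveOfNumericsZAx F N (stage12NumericsOfThm1CCMWB …) ε₂₉ … Efl logz` (= the χ witness at `chiFixed29Ax F N ν ε₂₉`, `rfl`;
  `chiβOfRecord₁₃Ax (θᴬˣ) = chiFixed29Ax F N ν ε₂₉`, `rfl`) + EVERY face and row of §1 again under the Ax names (`theta13OfThm1CCMWZBAx_<field>`, `<row with CCMWZBAx>`).

HONEST FRAMING.  A definition edition in the χ slot + `rfl` views + instantiation BY NAME of this seat's χ rows; NO closed value of `E_k`, `log z_k` or of χ is pinned for anybody;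
nothing of Bałaban's asserted, ported or discharged; no proviso content proved; K0ᴬ stmt-QuantumFields-27238 ∕ K1ᴬ 27239 ∕ K3ᴬ 27247 OPEN (door supply only; K2ᴬ 27246 proved by
name); COUNT 8∕28 · K 1∕4 of record UNMOVED; one finite 𝕋⁴ programme at fixed `ε = L^{-K}` — NOT continuum ∕ ℝ⁴ ∕ OS; the Yang–Mills mass gap (Clay) is NOT proved by any of this.
No `sorry`, no `axiom`, no `instance`, no `notation`; standard axioms only.
-/

noncomputable section

open MeasureTheory
open scoped Matrix.Norms.L2Operator

namespace Literature.MathematicalPhysics.QuantumFieldTheory.Balaban1983to89.Node00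

open T4Continuum AveragingRT T4FiniteEpsInhabited FlowStep FlowStepRuns DagBinding T4DatumAssembly B4GaugeCovariance

/-! ## §1. ★★ THE WITNESS `θ₁₅ᶜᶜᴹᵂᶻᴮ(j; γ; εbg)` IN THE χ SLOT, its faces and rows -/

section WitnessZBChi

variable (F : T4Family) (N : ℕ) [NeZero N] (j : ℕ) (γ εbg ε₀ ε₂₉ B₃ B₃' a₀ a₁ : ℝ) (Efl logz : B12.RunParams → ℕ → ℝ) (χ : ChiSlot F N)

/-- **THE WINDOWED COLLARED STAGE-13 z-WITNESS WITH THE BACKGROUND RADIUS A LETTER, IN THE χ SLOT** (DEF-1's `theta13OfThm1CCMWZB` :128 with the live re-pin read through `χ`; at `χ := chiβOfRecord₁₃ (theta13OfThm1CCMWZB …)` it IS DEF-1's witness, `rfl`) — `θ₁₅ᶜᶜᴹᵂᶻᴮ(j; γ; εbg; ε₀, ε₂₉; B₃, B₃′, a₀, a₁; Efl, logz)`: Z2's all-numerics family with the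
letters `theta13LiveOfNumericsZ` AT `stage12NumericsOfThm1CCMWB F.L j γ εbg ε₀ B₃ B₃' a₀ a₁`, with K0b's residuals of record — A1ʷ's member with `εbg` open; at `εbg = 1` it IS Z2's
`θ₁₅ᶜᶜᴹᵂᶻ(j; γ)`. [cite: Balaban1989LargeFieldI, (0.3) p.176 and p.177; Balaban1987RG1, Thm 1 p.259, (0.21) p.256; Balaban1985Variational, Thm 1 p.279; Balaban1988Convergent, (1.15) p.249, (2.4) p.255, (2.10) p.256; Balaban1989LargeFieldII, (0.15) p.360 (bookkeeping witness)] -/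
def theta13OfThm1CCMWZBChi : Stage13Params F N :=
  theta13LiveOfNumericsZChi F N (stage12NumericsOfThm1CCMWB F.L j γ εbg ε₀ B₃ B₃' a₀ a₁) ε₂₉
    (zeta316OfRecord F N (stage12NumericsOfThm1CCMWB F.L j γ εbg ε₀ B₃ B₃' a₀ a₁).ν (stage12NumericsOfThm1CCMWB F.L j γ εbg ε₀ B₃ B₃' a₀ a₁).τ9.M
      (stage12NumericsOfThm1CCMWB F.L j γ εbg ε₀ B₃ B₃' a₀ a₁).A₁)
    (RzOfRecord F N) (ZtOfRecord F N) Efl logz χ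

/-- Unfolding (`rfl`): the witness IS the member of Z2's live family at the B numerics. [cite: Balaban1989LargeFieldI, (0.3) p.176 (bookkeeping)] -/
theorem theta13OfThm1CCMWZBChi_eq :
    theta13OfThm1CCMWZBChi F N j γ εbg ε₀ ε₂₉ B₃ B₃' a₀ a₁ Efl logz χ =
      theta13LiveOfNumericsZChi F N (stage12NumericsOfThm1CCMWB F.L j γ εbg ε₀ B₃ B₃' a₀ a₁) ε₂₉
        (zeta316OfRecord F N (stage12NumericsOfThm1CCMWB F.L j γ εbg ε₀ B₃ B₃' a₀ a₁).ν (stage12NumericsOfThm1CCMWB F.L j γ εbg ε₀ B₃ B₃' a₀ a₁).τ9.M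
          (stage12NumericsOfThm1CCMWB F.L j γ εbg ε₀ B₃ B₃' a₀ a₁).A₁)
        (RzOfRecord F N) (ZtOfRecord F N) Efl logz χ := rfl

/-! ### Faces at the χ witness (token-pass, `rfl`) -/

/-- ★ FACE (`rfl`): **`θ₁₅ᶜᶜᴹᵂᶻᴮ.εbg = εbg`** — the background radius IS the letter. [cite: Balaban1987RG1, (0.21) p.256 (bookkeeping)] -/
theorem theta13OfThm1CCMWZBChi_εbg : (theta13OfThm1CCMWZBChi F N j γ εbg ε₀ ε₂₉ B₃ B₃' a₀ a₁ Efl logz χ).εbg = εbg := rfl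

/-- FACE (`rfl`): `Efl`. [cite: Balaban1988Convergent, (1.15) p.249 (bookkeeping)] -/
theorem theta13OfThm1CCMWZBChi_Efl : (theta13OfThm1CCMWZBChi F N j γ εbg ε₀ ε₂₉ B₃ B₃' a₀ a₁ Efl logz χ).Efl = Efl := rfl

/-- FACE (`rfl`): `logz`. [cite: Balaban1989LargeFieldII, (0.15) p.360 (bookkeeping)] -/
theorem theta13OfThm1CCMWZBChi_logz : (theta13OfThm1CCMWZBChi F N j γ εbg ε₀ ε₂₉ B₃ B₃' a₀ a₁ Efl logz χ).logz = logz := rfl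

/-- FACE (`rfl`): window `γ`. [cite: Balaban1987RG1, Thm 1 p.259 (bookkeeping)] -/
theorem theta13OfThm1CCMWZBChi_γ : (theta13OfThm1CCMWZBChi F N j γ εbg ε₀ ε₂₉ B₃ B₃' a₀ a₁ Efl logz χ).γ = γ := rfl

/-- FACE (`rfl`): Stage-7 numerics. [cite: Balaban1988Convergent, (2.4) p.255 (bookkeeping)] -/
theorem theta13OfThm1CCMWZBChi_ν : (theta13OfThm1CCMWZBChi F N j γ εbg ε₀ ε₂₉ B₃ B₃' a₀ a₁ Efl logz χ).ν = numerics7OfThm1CCM F.L j ε₀ B₃ B₃' a₀ a₁ := rfl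

/-- FACE (`rfl`): cut-off radius `ν.εreg = a₀`. [cite: Balaban1985Variational, Thm 1 p.279; Balaban1987RG1, (1.2) p.260 (bookkeeping)] -/
theorem theta13OfThm1CCMWZBChi_εreg : (theta13OfThm1CCMWZBChi F N j γ εbg ε₀ ε₂₉ B₃ B₃' a₀ a₁ Efl logz χ).ν.εreg = a₀ := rfl

/-- FACE (`rfl`): `ν.A₀ = A₀ᶜᶜ¹`. [cite: Balaban1985Variational, Thm 1 p.279 (bookkeeping)] -/
theorem theta13OfThm1CCMWZBChi_A₀ : (theta13OfThm1CCMWZBChi F N j γ εbg ε₀ ε₂₉ B₃ B₃' a₀ a₁ Efl logz χ).ν.A₀ = A0OfThm1CC1 F.L B₃ B₃' a₀ a₁ := rfl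

/-- FACE (`rfl`): `ν.M₁ = F.L ^ j`. [cite: Balaban1985RegularSpaces, (1.3)–(1.6) p.77 (bookkeeping)] -/
theorem theta13OfThm1CCMWZBChi_M₁ : (theta13OfThm1CCMWZBChi F N j γ εbg ε₀ ε₂₉ B₃ B₃' a₀ a₁ Efl logz χ).ν.M₁ = F.L ^ j := rfl

/-- FACE (`rfl`): `ν.M₂ = 1`. [cite: Balaban1988Convergent, (2.13)–(2.14) p.257 (bookkeeping)] -/
theorem theta13OfThm1CCMWZBChi_M₂ : (theta13OfThm1CCMWZBChi F N j γ εbg ε₀ ε₂₉ B₃ B₃' a₀ a₁ Efl logz χ).ν.M₂ = 1 := rfl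

/-- FACE (`rfl`): `ν.p₀ = 1`. [cite: Balaban1988Convergent, (2.5) p.255 (bookkeeping)] -/
theorem theta13OfThm1CCMWZBChi_p₀ : (theta13OfThm1CCMWZBChi F N j γ εbg ε₀ ε₂₉ B₃ B₃' a₀ a₁ Efl logz χ).ν.p₀ = 1 := rfl

/-- FACE (`rfl`): `ν.r = 1`. [cite: Balaban1988Convergent, (2.13)–(2.14) p.257 (bookkeeping)] -/
theorem theta13OfThm1CCMWZBChi_r : (theta13OfThm1CCMWZBChi F N j γ εbg ε₀ ε₂₉ B₃ B₃' a₀ a₁ Efl logz χ).ν.r = 1 := rfl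

/-- FACE (`rfl`): small-field threshold `ν.ε₀ = ε₀`. [cite: Balaban1988Convergent, (2.4) p.255 (bookkeeping)] -/
theorem theta13OfThm1CCMWZBChi_ε₀ : (theta13OfThm1CCMWZBChi F N j γ εbg ε₀ ε₂₉ B₃ B₃' a₀ a₁ Efl logz χ).ν.ε₀ = ε₀ := rfl

/-- FACE (`rfl`): the (2.9) letter. [cite: Balaban1987RG1, (2.9) p.266 (bookkeeping)] -/
theorem theta13OfThm1CCMWZBChi_ε₂₉ : (theta13OfThm1CCMWZBChi F N j γ εbg ε₀ ε₂₉ B₃ B₃' a₀ a₁ Efl logz χ).ε₂₉ = ε₂₉ := rfl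

/-- FACE (`rfl`): §2 numerics. [cite: Balaban1988Convergent, (2.28) p.259 (bookkeeping)] -/
theorem theta13OfThm1CCMWZBChi_s2 : (theta13OfThm1CCMWZBChi F N j γ εbg ε₀ ε₂₉ B₃ B₃' a₀ a₁ Efl logz χ).s2 = sect2NumericsOfThm1C F.L := rfl

/-- FACE (`rfl`): `s2.cB = 6L + 1`. [cite: Balaban1988Convergent, (2.28) p.259 (bookkeeping)] -/
theorem theta13OfThm1CCMWZBChi_cB : (theta13OfThm1CCMWZBChi F N j γ εbg ε₀ ε₂₉ B₃ B₃' a₀ a₁ Efl logz χ).s2.cB = 6 * F.L + 1 := rfl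

/-- FACE (`rfl`): `s2.B = 7`. [cite: Balaban1988Convergent, (2.34) p.261 (bookkeeping)] -/
theorem theta13OfThm1CCMWZBChi_B : (theta13OfThm1CCMWZBChi F N j γ εbg ε₀ ε₂₉ B₃ B₃' a₀ a₁ Efl logz χ).s2.B = 7 := rfl

/-- FACE (`rfl`): `s2.C = 1`. [cite: Balaban1988Convergent, (2.35) p.261 (bookkeeping)] -/
theorem theta13OfThm1CCMWZBChi_C : (theta13OfThm1CCMWZBChi F N j γ εbg ε₀ ε₂₉ B₃ B₃' a₀ a₁ Efl logz χ).s2.C = 1 := rfl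

/-- FACE (`rfl`): `s2.Mr = 1`. [cite: Balaban1988Convergent, (2.36) p.261 (bookkeeping)] -/
theorem theta13OfThm1CCMWZBChi_Mr : (theta13OfThm1CCMWZBChi F N j γ εbg ε₀ ε₂₉ B₃ B₃' a₀ a₁ Efl logz χ).s2.Mr = 1 := rfl

/-- FACE (`rfl`): `s2.cR = 1`. [cite: Balaban1988Convergent, (3.4) p.265 (bookkeeping)] -/
theorem theta13OfThm1CCMWZBChi_cR : (theta13OfThm1CCMWZBChi F N j γ εbg ε₀ ε₂₉ B₃ B₃' a₀ a₁ Efl logz χ).s2.cR = 1 := rfl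

/-- FACE (`rfl`): `s2.βc = ¼`. [cite: Balaban1988Convergent, (2.38) p.261 (bookkeeping)] -/
theorem theta13OfThm1CCMWZBChi_βc : (theta13OfThm1CCMWZBChi F N j γ εbg ε₀ ε₂₉ B₃ B₃' a₀ a₁ Efl logz χ).s2.βc = 1 / 4 := rfl

/-- FACE (`rfl`): `s2.lf.κ = 20000`. [cite: Balaban1987RG1, (0.25)–(0.26) p.257 (bookkeeping)] -/
theorem theta13OfThm1CCMWZBChi_κ : (theta13OfThm1CCMWZBChi F N j γ εbg ε₀ ε₂₉ B₃ B₃' a₀ a₁ Efl logz χ).s2.lf.κ = 20000 := rfl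

/-- FACE (`rfl`): cube letter `τ9.M = F.L ^ j`. [cite: Balaban1989LargeFieldI, (i)–(ii) p.177; Balaban1988Convergent, (2.1) p.254; Balaban1987RG1, (1.12) p.262 (bookkeeping)] -/
theorem theta13OfThm1CCMWZBChi_τ9_M : (theta13OfThm1CCMWZBChi F N j γ εbg ε₀ ε₂₉ B₃ B₃' a₀ a₁ Efl logz χ).τ9.M = F.L ^ j := rfl

/-- FACE (`rfl`): `A₁ = 1`. [cite: Balaban1988Convergent, (3.16) p.268 (bookkeeping)] -/
theorem theta13OfThm1CCMWZBChi_A₁ : (theta13OfThm1CCMWZBChi F N j γ εbg ε₀ ε₂₉ B₃ B₃' a₀ a₁ Efl logz χ).A₁ = 1 := rfl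

/-- FACE (`rfl`): `Rz = RzOfRecord`. [cite: Balaban1988Convergent, (2.21) p.258 (bookkeeping)] -/
theorem theta13OfThm1CCMWZBChi_Rz : (theta13OfThm1CCMWZBChi F N j γ εbg ε₀ ε₂₉ B₃ B₃' a₀ a₁ Efl logz χ).Rz = RzOfRecord F N := rfl

/-- … block size of the family: `ℓ₆ + 1 = F.L`. [cite: Balaban1987RG1, (0.1) p.251 (bookkeeping)] -/
theorem theta13OfThm1CCMWZBChi_ℓ₆_succ : (theta13OfThm1CCMWZBChi F N j γ εbg ε₀ ε₂₉ B₃ B₃' a₀ a₁ Efl logz χ).ℓ₆ + 1 = F.L := stage3OfFamily_ℓ₆_succ F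

/-- N10's Lemma-3 level-T binder: `8 ≤ θ.ℓ₆ + 1`. [cite: Balaban1987RG1, (0.1) p.251; Balaban1988RG2Cluster, (2.36) p.19] -/
theorem eight_le_L_theta13OfThm1CCMWZB_chi : 8 ≤ (theta13OfThm1CCMWZBChi F N j γ εbg ε₀ ε₂₉ B₃ B₃' a₀ a₁ Efl logz χ).ℓ₆ + 1 := eight_le_L_stage3OfFamily F

/-- Row N1: the (D4) `tree` numeral. [cite: Balaban1987RG1, (0.25)–(0.26) p.257] -/
theorem kp_tree_theta13OfThm1CCMWZB_chi : 128 * Real.log 162 ≤ (theta13OfThm1CCMWZBChi F N j γ εbg ε₀ ε₂₉ B₃ B₃' a₀ a₁ Efl logz χ).s2.lf.κ := kp_tree_lfConstsOfFamily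

/-- Row N1: the (D4) `large` numeral at the family's block size. [cite: Balaban1987RG1, (0.25)–(0.26) p.257; Balaban1988RG2Cluster, p.21 (after (2.39))] -/
theorem kp_large_theta13OfThm1CCMWZB_chi :
    10 * (64 * Real.log 162 + 1) ≤
      (((((theta13OfThm1CCMWZBChi F N j γ εbg ε₀ ε₂₉ B₃ B₃' a₀ a₁ Efl logz χ).ℓ₆ + 1 : ℕ) : ℝ)) / 2 - 1) *
        (theta13OfThm1CCMWZBChi F N j γ εbg ε₀ ε₂₉ B₃ B₃' a₀ a₁ Efl logz χ).s2.lf.κ :=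
  kp_large_theta13OfThm1CCM F N j ε₀ ε₂₉ B₃ B₃' a₀ a₁

/-- Row N1: N10's rate threshold. [cite: Balaban1987RG1, (1.18) p.263 (bookkeeping numeral)] -/
theorem kp_n10_theta13OfThm1CCMWZB_chi : (2 * 10 ^ 4 : ℝ) ≤ (theta13OfThm1CCMWZBChi F N j γ εbg ε₀ ε₂₉ B₃ B₃' a₀ a₁ Efl logz χ).s2.lf.κ := kp_n10_lfConstsOfFamily

/-! ### Rows `HasResidualsOfRecord` ∕ Z ∕ G ∕ P12 at the χ witness — by `Record13NumericsOfThm1CCMZChi`'s `n`-generic χ rows -/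

/-- `θ₁₅ᶜᶜᴹᵂᶻᴮ` carries K0b's residuals of record (`⟨rfl, rfl, rfl⟩`; the letter is not read). [cite: Balaban1988Convergent, (3.16) p.268, (2.21) p.258, (3.20) p.269 (bookkeeping)] -/
theorem hasResidualsOfRecord_theta13OfThm1CCMWZB_chi : (theta13OfThm1CCMWZBChi F N j γ εbg ε₀ ε₂₉ B₃ B₃' a₀ a₁ Efl logz χ).HasResidualsOfRecord F N :=
  hasResidualsOfRecord_theta13LiveOfNumericsZ_chi F N (stage12NumericsOfThm1CCMWB F.L j γ εbg ε₀ B₃ B₃' a₀ a₁) ε₂₉ Efl logz χ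

/-- **Row Z (`ZtUnity`) at `θ₁₅ᶜᶜᴹᵂᶻᴮ`.** [cite: Balaban1988Convergent, (3.16)–(3.20) pp.268–269] -/
theorem ztUnity_theta13OfThm1CCMWZB_chi : (theta13OfThm1CCMWZBChi F N j γ εbg ε₀ ε₂₉ B₃ B₃' a₀ a₁ Efl logz χ).ZtUnity F N :=
  ztUnity_theta13LiveOfNumericsZ_chi F N (stage12NumericsOfThm1CCMWB F.L j γ εbg ε₀ B₃ B₃' a₀ a₁) ε₂₉ Efl logz χ

variable {j γ εbg ε₀ ε₂₉ B₃ B₃' a₀ a₁} in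
/-- **Row G: `θ₁₅ᶜᶜᴹᵂᶻᴮ` IS STAGE-13 ADMISSIBLE under `0 < γ < 1`, THE NEW SIGN `0 < εbg`, and the signs `0 < ε₀`, `0 < ε₂₉`, `0 ≤ B₃`, `0 ≤ B₃′`, `0 < a₀`, `0 < a₁`** — whatever the
letters `Efl`, `logz`. [cite: Balaban1987RG1, Thm 1 p.259, (0.21) p.256, (2.9) p.266; Balaban1988Convergent, (2.10) p.256 (bookkeeping)] -/
theorem admissible_theta13OfThm1CCMWZB_chi (hγ0 : 0 < γ) (hγ1 : γ < 1) (hbg : 0 < εbg) (hε : 0 < ε₀) (hε' : 0 < ε₂₉) (hB : 0 ≤ B₃) (hB' : 0 ≤ B₃') (ha₀ : 0 < a₀) (ha₁ : 0 < a₁) :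
    (theta13OfThm1CCMWZBChi F N j γ εbg ε₀ ε₂₉ B₃ B₃' a₀ a₁ Efl logz χ).Admissible F N :=
  admissible_theta13LiveOfNumericsZ_chi F N _ _ _ Efl logz χ (stage12NumericsOfThm1CCMWB_pos F.hL.2.le hγ0 hγ1 hbg hε hB hB' ha₀ ha₁) hε'

variable {j γ εbg ε₀ ε₂₉ B₃ B₃' a₀ a₁} in
/-- … in particular on the range `0 < γ ≤ ½` of the window letter. [cite: Balaban1987RG1, Thm 1 p.259 (bookkeeping)] -/
theorem admissible_theta13OfThm1CCMWZB_of_le_half_chi (hγ0 : 0 < γ) (hγ : γ ≤ 1 / 2) (hbg : 0 < εbg) (hε : 0 < ε₀) (hε' : 0 < ε₂₉) (hB : 0 ≤ B₃) (hB' : 0 ≤ B₃') (ha₀ : 0 < a₀)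
    (ha₁ : 0 < a₁) : (theta13OfThm1CCMWZBChi F N j γ εbg ε₀ ε₂₉ B₃ B₃' a₀ a₁ Efl logz χ).Admissible F N :=
  admissible_theta13OfThm1CCMWZB_chi F N Efl logz χ hγ0 (hγ.trans_lt (by norm_num)) hbg hε hε' hB hB' ha₀ ha₁

variable {j γ ε₀ ε₂₉ B₃ B₃' a₀ a₁} in
/-- **Row G at THE PRINT-REGIME MEMBER `εbg := a₀`** under A1ʷ's signs alone. [cite: Balaban1985Variational, Thm 1 p.279; Balaban1987RG1, (0.21) p.256, (1.2) p.260 (bookkeeping)] -/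
theorem admissible_theta13OfThm1CCMWZB_regime_chi (hγ0 : 0 < γ) (hγ1 : γ < 1) (hε : 0 < ε₀) (hε' : 0 < ε₂₉) (hB : 0 ≤ B₃) (hB' : 0 ≤ B₃') (ha₀ : 0 < a₀) (ha₁ : 0 < a₁) :
    (theta13OfThm1CCMWZBChi F N j γ a₀ ε₀ ε₂₉ B₃ B₃' a₀ a₁ Efl logz χ).Admissible F N :=
  admissible_theta13OfThm1CCMWZB_chi F N Efl logz χ hγ0 hγ1 ha₀ hε hε' hB hB' ha₀ ha₁

/-- **★ Row P12 at `θ₁₅ᶜᶜᴹᵂᶻᴮ` HYPOTHESIS-FREE, LETTER-GENERIC** (Z2's `slotsNondegenerate₁₃_theta13LiveOfNumericsZ_of_hasResiduals`). [cite: Balaban1988Convergent, (3.22) p.269, (3.24) p.270; Balaban1989LargeFieldI, (0.3)–(0.4) p.176] -/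
theorem slotsNondegenerate₁₃_theta13OfThm1CCMWZB_chi : (theta13OfThm1CCMWZBChi F N j γ εbg ε₀ ε₂₉ B₃ B₃' a₀ a₁ Efl logz χ).SlotsNondegenerate₁₃Chi F N χ :=
  slotsNondegenerate₁₃_theta13LiveOfNumericsZ_of_hasResiduals_chi F N (stage12NumericsOfThm1CCMWB F.L j γ εbg ε₀ B₃ B₃' a₀ a₁) ε₂₉ Efl logz χ

/-- Row P12 at `θ₁₅ᶜᶜᴹᵂᶻᴮ` from `Provisos₁₃` there (the proviso-keyed form some consumers hold). [cite: Balaban1988Convergent, (3.22) p.269; Balaban1989LargeFieldI, (0.3)–(0.4) p.176] -/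
theorem slotsNondegenerate₁₃_theta13OfThm1CCMWZB_of_provisos_chi (h : (theta13OfThm1CCMWZBChi F N j γ εbg ε₀ ε₂₉ B₃ B₃' a₀ a₁ Efl logz χ).Provisos₁₃Chi F N χ) :
    (theta13OfThm1CCMWZBChi F N j γ εbg ε₀ ε₂₉ B₃ B₃' a₀ a₁ Efl logz χ).SlotsNondegenerate₁₃Chi F N χ :=
  slotsNondegenerate₁₃_theta13LiveOfNumericsZ_chi F N _ _ _ _ _ Efl logz χ h

/-! ### The N09 regime letters at the χ witness (χ-blind numerics; `le_rfl`) -/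

/-- **AT THE PRINT-REGIME MEMBER `εbg := a₀`: `θ.εbg ≤ a₀`** ([B11] Thm 1's regime letter of `…N09BackgroundRadiiReg8OfThm1Objects.hreg8_of_thm1Objects_of_ukRows`; compare its LOCATED
`not_εbg_le_a₀_theta13OfThm1CCMW` at the `εbg = 1` members). [cite: Balaban1985Variational, Thm 1 p.279; Balaban1987RG1, (1.2) p.260 (bookkeeping)] -/
theorem εbg_le_a₀_theta13OfThm1CCMWZB_regime_chi : (theta13OfThm1CCMWZBChi F N j γ a₀ ε₀ ε₂₉ B₃ B₃' a₀ a₁ Efl logz χ).εbg ≤ a₀ := le_rfl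

/-- **AT THE PRINT-REGIME MEMBER: `ν.εreg ≤ θ.εbg`** (the two-radii letter `εreg ≤ εbg` of N09's roads, with equality). [cite: Balaban1985Variational, Thm 1 (8) p.279; Balaban1987RG1, (0.21) p.256, (1.2) p.260 (bookkeeping)] -/
theorem εreg_le_εbg_theta13OfThm1CCMWZB_regime_chi :
    (theta13OfThm1CCMWZBChi F N j γ a₀ ε₀ ε₂₉ B₃ B₃' a₀ a₁ Efl logz χ).ν.εreg ≤ (theta13OfThm1CCMWZBChi F N j γ a₀ ε₀ ε₂₉ B₃ B₃' a₀ a₁ Efl logz χ).εbg := le_rfl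

variable {εbg a₀} in
/-- **AT A GENERAL MEMBER: the two regime letters read on the free pair `(a₀, εbg)`** — `ν.εreg ≤ θ.εbg ≤ a₀` iff `a₀ ≤ εbg ≤ a₀`, i.e. exactly at `εbg = a₀`; displayed as the
implication the consumer uses. [cite: Balaban1985Variational, Thm 1 p.279; Balaban1987RG1, (0.21) p.256, (1.2) p.260 (bookkeeping)] -/
theorem regimeLetters_theta13OfThm1CCMWZB_chi (h₁ : a₀ ≤ εbg) (h₂ : εbg ≤ a₀) :
    (theta13OfThm1CCMWZBChi F N j γ εbg ε₀ ε₂₉ B₃ B₃' a₀ a₁ Efl logz χ).ν.εreg ≤ (theta13OfThm1CCMWZBChi F N j γ εbg ε₀ ε₂₉ B₃ B₃' a₀ a₁ Efl logz χ).εbg ∧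
      (theta13OfThm1CCMWZBChi F N j γ εbg ε₀ ε₂₉ B₃ B₃' a₀ a₁ Efl logz χ).εbg ≤ a₀ :=
  ⟨h₁, h₂⟩

/-- FACE (`rfl`): the record's own β-slot of the χ witness is `chiFixed29 F N ν ε₂₉` at the B numerics. [cite: Balaban1987RG1, (2.9) p.266 (bookkeeping)] -/
theorem chiβOfRecord₁₃_theta13OfThm1CCMWZBChi :
    chiβOfRecord₁₃ F N (theta13OfThm1CCMWZBChi F N j γ εbg ε₀ ε₂₉ B₃ B₃' a₀ a₁ Efl logz χ) = chiFixed29 F N (numerics7OfThm1CCM F.L j ε₀ B₃ B₃' a₀ a₁) ε₂₉ := rfl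

/-- FACE (`rfl`): the re-centred β-slot of the χ witness is `chiFixed29Ax F N ν ε₂₉` at the B numerics. [cite: Balaban1987RG1, (2.9) p.266, p.265 (2.3) (bookkeeping)] -/
theorem chiβOfRecord₁₃Ax_theta13OfThm1CCMWZBChi :
    chiβOfRecord₁₃Ax F N (theta13OfThm1CCMWZBChi F N j γ εbg ε₀ ε₂₉ B₃ B₃' a₀ a₁ Efl logz χ) = chiFixed29Ax F N (numerics7OfThm1CCM F.L j ε₀ B₃ B₃' a₀ a₁) ε₂₉ := rfl

end WitnessZBChi

/-! ## §R. RECEIPTS AT THE RECORD'S OWN SLOT: the χ witness at `χ := chiβOfRecord₁₃ θ₁₅ᶜᶜᴹᵂᶻᴮ` IS DEF-1's `theta13OfThm1CCMWZB` (`rfl`) -/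

section Receipts

variable {F : T4Family} {N : ℕ} [NeZero N] (j : ℕ) (γ εbg ε₀ ε₂₉ B₃ B₃' a₀ a₁ : ℝ) (Efl logz : B12.RunParams → ℕ → ℝ)

/-- `theta13OfThm1CCMWZBChi … (chiβOfRecord₁₃ θ₁₅ᶜᶜᴹᵂᶻᴮ) = theta13OfThm1CCMWZB …` (`rfl`). [cite: Balaban1989LargeFieldI, (0.3) p.176 (bookkeeping)] -/
theorem theta13OfThm1CCMWZBChi_chiβ :
    theta13OfThm1CCMWZBChi F N j γ εbg ε₀ ε₂₉ B₃ B₃' a₀ a₁ Efl logz (chiβOfRecord₁₃ F N (theta13OfThm1CCMWZB F N j γ εbg ε₀ ε₂₉ B₃ B₃' a₀ a₁ Efl logz)) =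
      theta13OfThm1CCMWZB F N j γ εbg ε₀ ε₂₉ B₃ B₃' a₀ a₁ Efl logz := rfl

/-- … in closed form: at `χ := chiFixed29 F N (numerics7OfThm1CCM …) ε₂₉` the χ witness IS DEF-1's (`rfl`). [cite: Balaban1987RG1, (2.9) p.266 (bookkeeping)] -/
theorem theta13OfThm1CCMWZBChi_chiFixed29 :
    theta13OfThm1CCMWZBChi F N j γ εbg ε₀ ε₂₉ B₃ B₃' a₀ a₁ Efl logz (chiFixed29 F N (numerics7OfThm1CCM F.L j ε₀ B₃ B₃' a₀ a₁) ε₂₉) =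
      theta13OfThm1CCMWZB F N j γ εbg ε₀ ε₂₉ B₃ B₃' a₀ a₁ Efl logz := rfl

/-- Row P12 in the χ slot at the record's own slot IS DEF-1's row P12 (`Iff.rfl`). [cite: Balaban1988Convergent, (3.22) p.269 (bookkeeping)] -/
theorem slotsNondegenerate₁₃Chi_theta13OfThm1CCMWZBChi_chiβ_iff :
    (theta13OfThm1CCMWZBChi F N j γ εbg ε₀ ε₂₉ B₃ B₃' a₀ a₁ Efl logz (chiFixed29 F N (numerics7OfThm1CCM F.L j ε₀ B₃ B₃' a₀ a₁) ε₂₉)).SlotsNondegenerate₁₃Chi F N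
        (chiFixed29 F N (numerics7OfThm1CCM F.L j ε₀ B₃ B₃' a₀ a₁) ε₂₉) ↔
      (theta13OfThm1CCMWZB F N j γ εbg ε₀ ε₂₉ B₃ B₃' a₀ a₁ Efl logz).SlotsNondegenerate₁₃ F N := Iff.rfl

/-- `Provisos₁₃Chi` in the χ slot at the record's own slot ⟺ DEF-1's `Provisos₁₃` ([Ax-3b]'s field-wise receipt). [cite: Balaban1988Convergent, (2.18) p.257 (bookkeeping)] -/
theorem provisos₁₃Chi_theta13OfThm1CCMWZBChi_chiβ_iff :
    (theta13OfThm1CCMWZBChi F N j γ εbg ε₀ ε₂₉ B₃ B₃' a₀ a₁ Efl logz (chiFixed29 F N (numerics7OfThm1CCM F.L j ε₀ B₃ B₃' a₀ a₁) ε₂₉)).Provisos₁₃Chi F N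
        (chiFixed29 F N (numerics7OfThm1CCM F.L j ε₀ B₃ B₃' a₀ a₁) ε₂₉) ↔
      (theta13OfThm1CCMWZB F N j γ εbg ε₀ ε₂₉ B₃ B₃' a₀ a₁ Efl logz).Provisos₁₃ F N :=
  provisos₁₃Chi_chiβ_iff (theta13OfThm1CCMWZB F N j γ εbg ε₀ ε₂₉ B₃ B₃' a₀ a₁ Efl logz)

end Receipts

/-! ## §A. ★★ THE RE-CENTRED WITNESS `theta13OfThm1CCMWZBAx` (same arity as the bare name; β-slot `chiFixed29Ax F N ν ε₂₉`) with every face and row -/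

section WitnessZBAx

variable (F : T4Family) (N : ℕ) [NeZero N] (j : ℕ) (γ εbg ε₀ ε₂₉ B₃ B₃' a₀ a₁ : ℝ) (Efl logz : B12.RunParams → ℕ → ℝ)

/-- **THE WINDOWED COLLARED STAGE-13 z-WITNESS WITH THE BACKGROUND RADIUS A LETTER, RE-CENTRED** (`= theta13OfThm1CCMWZBChi … (chiFixed29Ax F N ν ε₂₉)`, `rfl`; same arity as the bare name) — `θ₁₅ᶜᶜᴹᵂᶻᴮ(j; γ; εbg; ε₀, ε₂₉; B₃, B₃′, a₀, a₁; Efl, logz)`: Z2's all-numerics family with the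
letters `theta13LiveOfNumericsZ` AT `stage12NumericsOfThm1CCMWB F.L j γ εbg ε₀ B₃ B₃' a₀ a₁`, with K0b's residuals of record — A1ʷ's member with `εbg` open; at `εbg = 1` it IS Z2's
`θ₁₅ᶜᶜᴹᵂᶻ(j; γ)`. [cite: Balaban1989LargeFieldI, (0.3) p.176 and p.177; Balaban1987RG1, Thm 1 p.259, (0.21) p.256; Balaban1985Variational, Thm 1 p.279; Balaban1988Convergent, (1.15) p.249, (2.4) p.255, (2.10) p.256; Balaban1989LargeFieldII, (0.15) p.360 (bookkeeping witness)] -/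
abbrev theta13OfThm1CCMWZBAx : Stage13Params F N :=
  theta13LiveOfNumericsZAx F N (stage12NumericsOfThm1CCMWB F.L j γ εbg ε₀ B₃ B₃' a₀ a₁) ε₂₉
    (zeta316OfRecord F N (stage12NumericsOfThm1CCMWB F.L j γ εbg ε₀ B₃ B₃' a₀ a₁).ν (stage12NumericsOfThm1CCMWB F.L j γ εbg ε₀ B₃ B₃' a₀ a₁).τ9.M
      (stage12NumericsOfThm1CCMWB F.L j γ εbg ε₀ B₃ B₃' a₀ a₁).A₁)
    (RzOfRecord F N) (ZtOfRecord F N) Efl logz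

/-- Unfolding (`rfl`): the witness IS the member of Z2's live family at the B numerics. [cite: Balaban1989LargeFieldI, (0.3) p.176 (bookkeeping)] -/
theorem theta13OfThm1CCMWZBAx_eq :
    theta13OfThm1CCMWZBAx F N j γ εbg ε₀ ε₂₉ B₃ B₃' a₀ a₁ Efl logz =
      theta13LiveOfNumericsZAx F N (stage12NumericsOfThm1CCMWB F.L j γ εbg ε₀ B₃ B₃' a₀ a₁) ε₂₉
        (zeta316OfRecord F N (stage12NumericsOfThm1CCMWB F.L j γ εbg ε₀ B₃ B₃' a₀ a₁).ν (stage12NumericsOfThm1CCMWB F.L j γ εbg ε₀ B₃ B₃' a₀ a₁).τ9.M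
          (stage12NumericsOfThm1CCMWB F.L j γ εbg ε₀ B₃ B₃' a₀ a₁).A₁)
        (RzOfRecord F N) (ZtOfRecord F N) Efl logz := rfl

/-! ### Faces at the re-centred witness (token-pass, `rfl`) -/

/-- ★ FACE (`rfl`): **`θ₁₅ᶜᶜᴹᵂᶻᴮ.εbg = εbg`** — the background radius IS the letter. [cite: Balaban1987RG1, (0.21) p.256 (bookkeeping)] -/
theorem theta13OfThm1CCMWZBAx_εbg : (theta13OfThm1CCMWZBAx F N j γ εbg ε₀ ε₂₉ B₃ B₃' a₀ a₁ Efl logz).εbg = εbg := rfl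

/-- FACE (`rfl`): `Efl`. [cite: Balaban1988Convergent, (1.15) p.249 (bookkeeping)] -/
theorem theta13OfThm1CCMWZBAx_Efl : (theta13OfThm1CCMWZBAx F N j γ εbg ε₀ ε₂₉ B₃ B₃' a₀ a₁ Efl logz).Efl = Efl := rfl

/-- FACE (`rfl`): `logz`. [cite: Balaban1989LargeFieldII, (0.15) p.360 (bookkeeping)] -/
theorem theta13OfThm1CCMWZBAx_logz : (theta13OfThm1CCMWZBAx F N j γ εbg ε₀ ε₂₉ B₃ B₃' a₀ a₁ Efl logz).logz = logz := rfl

/-- FACE (`rfl`): window `γ`. [cite: Balaban1987RG1, Thm 1 p.259 (bookkeeping)] -/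
theorem theta13OfThm1CCMWZBAx_γ : (theta13OfThm1CCMWZBAx F N j γ εbg ε₀ ε₂₉ B₃ B₃' a₀ a₁ Efl logz).γ = γ := rfl

/-- FACE (`rfl`): Stage-7 numerics. [cite: Balaban1988Convergent, (2.4) p.255 (bookkeeping)] -/
theorem theta13OfThm1CCMWZBAx_ν : (theta13OfThm1CCMWZBAx F N j γ εbg ε₀ ε₂₉ B₃ B₃' a₀ a₁ Efl logz).ν = numerics7OfThm1CCM F.L j ε₀ B₃ B₃' a₀ a₁ := rfl

/-- FACE (`rfl`): cut-off radius `ν.εreg = a₀`. [cite: Balaban1985Variational, Thm 1 p.279; Balaban1987RG1, (1.2) p.260 (bookkeeping)] -/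
theorem theta13OfThm1CCMWZBAx_εreg : (theta13OfThm1CCMWZBAx F N j γ εbg ε₀ ε₂₉ B₃ B₃' a₀ a₁ Efl logz).ν.εreg = a₀ := rfl

/-- FACE (`rfl`): `ν.A₀ = A₀ᶜᶜ¹`. [cite: Balaban1985Variational, Thm 1 p.279 (bookkeeping)] -/
theorem theta13OfThm1CCMWZBAx_A₀ : (theta13OfThm1CCMWZBAx F N j γ εbg ε₀ ε₂₉ B₃ B₃' a₀ a₁ Efl logz).ν.A₀ = A0OfThm1CC1 F.L B₃ B₃' a₀ a₁ := rfl

/-- FACE (`rfl`): `ν.M₁ = F.L ^ j`. [cite: Balaban1985RegularSpaces, (1.3)–(1.6) p.77 (bookkeeping)] -/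
theorem theta13OfThm1CCMWZBAx_M₁ : (theta13OfThm1CCMWZBAx F N j γ εbg ε₀ ε₂₉ B₃ B₃' a₀ a₁ Efl logz).ν.M₁ = F.L ^ j := rfl

/-- FACE (`rfl`): `ν.M₂ = 1`. [cite: Balaban1988Convergent, (2.13)–(2.14) p.257 (bookkeeping)] -/
theorem theta13OfThm1CCMWZBAx_M₂ : (theta13OfThm1CCMWZBAx F N j γ εbg ε₀ ε₂₉ B₃ B₃' a₀ a₁ Efl logz).ν.M₂ = 1 := rfl

/-- FACE (`rfl`): `ν.p₀ = 1`. [cite: Balaban1988Convergent, (2.5) p.255 (bookkeeping)] -/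
theorem theta13OfThm1CCMWZBAx_p₀ : (theta13OfThm1CCMWZBAx F N j γ εbg ε₀ ε₂₉ B₃ B₃' a₀ a₁ Efl logz).ν.p₀ = 1 := rfl

/-- FACE (`rfl`): `ν.r = 1`. [cite: Balaban1988Convergent, (2.13)–(2.14) p.257 (bookkeeping)] -/
theorem theta13OfThm1CCMWZBAx_r : (theta13OfThm1CCMWZBAx F N j γ εbg ε₀ ε₂₉ B₃ B₃' a₀ a₁ Efl logz).ν.r = 1 := rfl

/-- FACE (`rfl`): small-field threshold `ν.ε₀ = ε₀`. [cite: Balaban1988Convergent, (2.4) p.255 (bookkeeping)] -/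
theorem theta13OfThm1CCMWZBAx_ε₀ : (theta13OfThm1CCMWZBAx F N j γ εbg ε₀ ε₂₉ B₃ B₃' a₀ a₁ Efl logz).ν.ε₀ = ε₀ := rfl

/-- FACE (`rfl`): the (2.9) letter. [cite: Balaban1987RG1, (2.9) p.266 (bookkeeping)] -/
theorem theta13OfThm1CCMWZBAx_ε₂₉ : (theta13OfThm1CCMWZBAx F N j γ εbg ε₀ ε₂₉ B₃ B₃' a₀ a₁ Efl logz).ε₂₉ = ε₂₉ := rfl

/-- FACE (`rfl`): §2 numerics. [cite: Balaban1988Convergent, (2.28) p.259 (bookkeeping)] -/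
theorem theta13OfThm1CCMWZBAx_s2 : (theta13OfThm1CCMWZBAx F N j γ εbg ε₀ ε₂₉ B₃ B₃' a₀ a₁ Efl logz).s2 = sect2NumericsOfThm1C F.L := rfl

/-- FACE (`rfl`): `s2.cB = 6L + 1`. [cite: Balaban1988Convergent, (2.28) p.259 (bookkeeping)] -/
theorem theta13OfThm1CCMWZBAx_cB : (theta13OfThm1CCMWZBAx F N j γ εbg ε₀ ε₂₉ B₃ B₃' a₀ a₁ Efl logz).s2.cB = 6 * F.L + 1 := rfl

/-- FACE (`rfl`): `s2.B = 7`. [cite: Balaban1988Convergent, (2.34) p.261 (bookkeeping)] -/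
theorem theta13OfThm1CCMWZBAx_B : (theta13OfThm1CCMWZBAx F N j γ εbg ε₀ ε₂₉ B₃ B₃' a₀ a₁ Efl logz).s2.B = 7 := rfl

/-- FACE (`rfl`): `s2.C = 1`. [cite: Balaban1988Convergent, (2.35) p.261 (bookkeeping)] -/
theorem theta13OfThm1CCMWZBAx_C : (theta13OfThm1CCMWZBAx F N j γ εbg ε₀ ε₂₉ B₃ B₃' a₀ a₁ Efl logz).s2.C = 1 := rfl

/-- FACE (`rfl`): `s2.Mr = 1`. [cite: Balaban1988Convergent, (2.36) p.261 (bookkeeping)] -/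
theorem theta13OfThm1CCMWZBAx_Mr : (theta13OfThm1CCMWZBAx F N j γ εbg ε₀ ε₂₉ B₃ B₃' a₀ a₁ Efl logz).s2.Mr = 1 := rfl

/-- FACE (`rfl`): `s2.cR = 1`. [cite: Balaban1988Convergent, (3.4) p.265 (bookkeeping)] -/
theorem theta13OfThm1CCMWZBAx_cR : (theta13OfThm1CCMWZBAx F N j γ εbg ε₀ ε₂₉ B₃ B₃' a₀ a₁ Efl logz).s2.cR = 1 := rfl

/-- FACE (`rfl`): `s2.βc = ¼`. [cite: Balaban1988Convergent, (2.38) p.261 (bookkeeping)] -/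
theorem theta13OfThm1CCMWZBAx_βc : (theta13OfThm1CCMWZBAx F N j γ εbg ε₀ ε₂₉ B₃ B₃' a₀ a₁ Efl logz).s2.βc = 1 / 4 := rfl

/-- FACE (`rfl`): `s2.lf.κ = 20000`. [cite: Balaban1987RG1, (0.25)–(0.26) p.257 (bookkeeping)] -/
theorem theta13OfThm1CCMWZBAx_κ : (theta13OfThm1CCMWZBAx F N j γ εbg ε₀ ε₂₉ B₃ B₃' a₀ a₁ Efl logz).s2.lf.κ = 20000 := rfl

/-- FACE (`rfl`): cube letter `τ9.M = F.L ^ j`. [cite: Balaban1989LargeFieldI, (i)–(ii) p.177; Balaban1988Convergent, (2.1) p.254; Balaban1987RG1, (1.12) p.262 (bookkeeping)] -/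
theorem theta13OfThm1CCMWZBAx_τ9_M : (theta13OfThm1CCMWZBAx F N j γ εbg ε₀ ε₂₉ B₃ B₃' a₀ a₁ Efl logz).τ9.M = F.L ^ j := rfl

/-- FACE (`rfl`): `A₁ = 1`. [cite: Balaban1988Convergent, (3.16) p.268 (bookkeeping)] -/
theorem theta13OfThm1CCMWZBAx_A₁ : (theta13OfThm1CCMWZBAx F N j γ εbg ε₀ ε₂₉ B₃ B₃' a₀ a₁ Efl logz).A₁ = 1 := rfl

/-- FACE (`rfl`): `Rz = RzOfRecord`. [cite: Balaban1988Convergent, (2.21) p.258 (bookkeeping)] -/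
theorem theta13OfThm1CCMWZBAx_Rz : (theta13OfThm1CCMWZBAx F N j γ εbg ε₀ ε₂₉ B₃ B₃' a₀ a₁ Efl logz).Rz = RzOfRecord F N := rfl

/-- … block size of the family: `ℓ₆ + 1 = F.L`. [cite: Balaban1987RG1, (0.1) p.251 (bookkeeping)] -/
theorem theta13OfThm1CCMWZBAx_ℓ₆_succ : (theta13OfThm1CCMWZBAx F N j γ εbg ε₀ ε₂₉ B₃ B₃' a₀ a₁ Efl logz).ℓ₆ + 1 = F.L := stage3OfFamily_ℓ₆_succ F

/-- N10's Lemma-3 level-T binder: `8 ≤ θ.ℓ₆ + 1`. [cite: Balaban1987RG1, (0.1) p.251; Balaban1988RG2Cluster, (2.36) p.19] -/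
theorem eight_le_L_theta13OfThm1CCMWZBAx : 8 ≤ (theta13OfThm1CCMWZBAx F N j γ εbg ε₀ ε₂₉ B₃ B₃' a₀ a₁ Efl logz).ℓ₆ + 1 := eight_le_L_stage3OfFamily F

/-- Row N1: the (D4) `tree` numeral. [cite: Balaban1987RG1, (0.25)–(0.26) p.257] -/
theorem kp_tree_theta13OfThm1CCMWZBAx : 128 * Real.log 162 ≤ (theta13OfThm1CCMWZBAx F N j γ εbg ε₀ ε₂₉ B₃ B₃' a₀ a₁ Efl logz).s2.lf.κ := kp_tree_lfConstsOfFamily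

/-- Row N1: the (D4) `large` numeral at the family's block size. [cite: Balaban1987RG1, (0.25)–(0.26) p.257; Balaban1988RG2Cluster, p.21 (after (2.39))] -/
theorem kp_large_theta13OfThm1CCMWZBAx :
    10 * (64 * Real.log 162 + 1) ≤
      (((((theta13OfThm1CCMWZBAx F N j γ εbg ε₀ ε₂₉ B₃ B₃' a₀ a₁ Efl logz).ℓ₆ + 1 : ℕ) : ℝ)) / 2 - 1) *
        (theta13OfThm1CCMWZBAx F N j γ εbg ε₀ ε₂₉ B₃ B₃' a₀ a₁ Efl logz).s2.lf.κ :=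
  kp_large_theta13OfThm1CCM F N j ε₀ ε₂₉ B₃ B₃' a₀ a₁

/-- Row N1: N10's rate threshold. [cite: Balaban1987RG1, (1.18) p.263 (bookkeeping numeral)] -/
theorem kp_n10_theta13OfThm1CCMWZBAx : (2 * 10 ^ 4 : ℝ) ≤ (theta13OfThm1CCMWZBAx F N j γ εbg ε₀ ε₂₉ B₃ B₃' a₀ a₁ Efl logz).s2.lf.κ := kp_n10_lfConstsOfFamily

/-! ### Rows `HasResidualsOfRecord` ∕ Z ∕ G ∕ P12 at the re-centred witness — the χ rows above at `χ := chiFixed29Ax F N ν ε₂₉` -/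

/-- `θ₁₅ᶜᶜᴹᵂᶻᴮ` carries K0b's residuals of record (`⟨rfl, rfl, rfl⟩`; the letter is not read). [cite: Balaban1988Convergent, (3.16) p.268, (2.21) p.258, (3.20) p.269 (bookkeeping)] -/
theorem hasResidualsOfRecord_theta13OfThm1CCMWZBAx : (theta13OfThm1CCMWZBAx F N j γ εbg ε₀ ε₂₉ B₃ B₃' a₀ a₁ Efl logz).HasResidualsOfRecord F N :=
  hasResidualsOfRecord_theta13OfThm1CCMWZB_chi F N j γ εbg ε₀ ε₂₉ B₃ B₃' a₀ a₁ Efl logz _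

/-- **Row Z (`ZtUnity`) at `θ₁₅ᶜᶜᴹᵂᶻᴮ`.** [cite: Balaban1988Convergent, (3.16)–(3.20) pp.268–269] -/
theorem ztUnity_theta13OfThm1CCMWZBAx : (theta13OfThm1CCMWZBAx F N j γ εbg ε₀ ε₂₉ B₃ B₃' a₀ a₁ Efl logz).ZtUnity F N :=
  ztUnity_theta13OfThm1CCMWZB_chi F N j γ εbg ε₀ ε₂₉ B₃ B₃' a₀ a₁ Efl logz _

variable {j γ εbg ε₀ ε₂₉ B₃ B₃' a₀ a₁} in
/-- **Row G: `θ₁₅ᶜᶜᴹᵂᶻᴮ` IS STAGE-13 ADMISSIBLE under `0 < γ < 1`, THE NEW SIGN `0 < εbg`, and the signs `0 < ε₀`, `0 < ε₂₉`, `0 ≤ B₃`, `0 ≤ B₃′`, `0 < a₀`, `0 < a₁`** — whatever the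
letters `Efl`, `logz`. [cite: Balaban1987RG1, Thm 1 p.259, (0.21) p.256, (2.9) p.266; Balaban1988Convergent, (2.10) p.256 (bookkeeping)] -/
theorem admissible_theta13OfThm1CCMWZBAx (hγ0 : 0 < γ) (hγ1 : γ < 1) (hbg : 0 < εbg) (hε : 0 < ε₀) (hε' : 0 < ε₂₉) (hB : 0 ≤ B₃) (hB' : 0 ≤ B₃') (ha₀ : 0 < a₀) (ha₁ : 0 < a₁) :
    (theta13OfThm1CCMWZBAx F N j γ εbg ε₀ ε₂₉ B₃ B₃' a₀ a₁ Efl logz).Admissible F N :=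
  admissible_theta13OfThm1CCMWZB_chi F N Efl logz _ (j := j) (B₃ := B₃) (B₃' := B₃') hγ0 hγ1 hbg hε hε' hB hB' ha₀ ha₁

variable {j γ εbg ε₀ ε₂₉ B₃ B₃' a₀ a₁} in
/-- … in particular on the range `0 < γ ≤ ½` of the window letter. [cite: Balaban1987RG1, Thm 1 p.259 (bookkeeping)] -/
theorem admissible_theta13OfThm1CCMWZBAx_of_le_half (hγ0 : 0 < γ) (hγ : γ ≤ 1 / 2) (hbg : 0 < εbg) (hε : 0 < ε₀) (hε' : 0 < ε₂₉) (hB : 0 ≤ B₃) (hB' : 0 ≤ B₃') (ha₀ : 0 < a₀)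
    (ha₁ : 0 < a₁) : (theta13OfThm1CCMWZBAx F N j γ εbg ε₀ ε₂₉ B₃ B₃' a₀ a₁ Efl logz).Admissible F N :=
  admissible_theta13OfThm1CCMWZBAx F N Efl logz hγ0 (hγ.trans_lt (by norm_num)) hbg hε hε' hB hB' ha₀ ha₁

variable {j γ ε₀ ε₂₉ B₃ B₃' a₀ a₁} in
/-- **Row G at THE PRINT-REGIME MEMBER `εbg := a₀`** under A1ʷ's signs alone. [cite: Balaban1985Variational, Thm 1 p.279; Balaban1987RG1, (0.21) p.256, (1.2) p.260 (bookkeeping)] -/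
theorem admissible_theta13OfThm1CCMWZBAx_regime (hγ0 : 0 < γ) (hγ1 : γ < 1) (hε : 0 < ε₀) (hε' : 0 < ε₂₉) (hB : 0 ≤ B₃) (hB' : 0 ≤ B₃') (ha₀ : 0 < a₀) (ha₁ : 0 < a₁) :
    (theta13OfThm1CCMWZBAx F N j γ a₀ ε₀ ε₂₉ B₃ B₃' a₀ a₁ Efl logz).Admissible F N :=
  admissible_theta13OfThm1CCMWZBAx F N Efl logz hγ0 hγ1 ha₀ hε hε' hB hB' ha₀ ha₁

/-- **★ Row P12 at `θ₁₅ᶜᶜᴹᵂᶻᴮ` HYPOTHESIS-FREE, LETTER-GENERIC** (Z2's `slotsNondegenerate₁₃_theta13LiveOfNumericsZ_of_hasResiduals`). [cite: Balaban1988Convergent, (3.22) p.269, (3.24) p.270; Balaban1989LargeFieldI, (0.3)–(0.4) p.176] -/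
theorem slotsNondegenerate₁₃_theta13OfThm1CCMWZBAx : (theta13OfThm1CCMWZBAx F N j γ εbg ε₀ ε₂₉ B₃ B₃' a₀ a₁ Efl logz).SlotsNondegenerate₁₃Ax F N :=
  slotsNondegenerate₁₃_theta13OfThm1CCMWZB_chi F N j γ εbg ε₀ ε₂₉ B₃ B₃' a₀ a₁ Efl logz _

/-- Row P12 at `θ₁₅ᶜᶜᴹᵂᶻᴮ` from `Provisos₁₃` there (the proviso-keyed form some consumers hold). [cite: Balaban1988Convergent, (3.22) p.269; Balaban1989LargeFieldI, (0.3)–(0.4) p.176] -/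
theorem slotsNondegenerate₁₃_theta13OfThm1CCMWZBAx_of_provisos (h : (theta13OfThm1CCMWZBAx F N j γ εbg ε₀ ε₂₉ B₃ B₃' a₀ a₁ Efl logz).Provisos₁₃Ax F N) :
    (theta13OfThm1CCMWZBAx F N j γ εbg ε₀ ε₂₉ B₃ B₃' a₀ a₁ Efl logz).SlotsNondegenerate₁₃Ax F N :=
  slotsNondegenerate₁₃_theta13OfThm1CCMWZB_of_provisos_chi F N j γ εbg ε₀ ε₂₉ B₃ B₃' a₀ a₁ Efl logz _ h

/-! ### The N09 regime letters at the re-centred witness -/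

/-- **AT THE PRINT-REGIME MEMBER `εbg := a₀`: `θ.εbg ≤ a₀`** ([B11] Thm 1's regime letter of `…N09BackgroundRadiiReg8OfThm1Objects.hreg8_of_thm1Objects_of_ukRows`; compare its LOCATED
`not_εbg_le_a₀_theta13OfThm1CCMW` at the `εbg = 1` members). [cite: Balaban1985Variational, Thm 1 p.279; Balaban1987RG1, (1.2) p.260 (bookkeeping)] -/
theorem εbg_le_a₀_theta13OfThm1CCMWZBAx_regime : (theta13OfThm1CCMWZBAx F N j γ a₀ ε₀ ε₂₉ B₃ B₃' a₀ a₁ Efl logz).εbg ≤ a₀ := le_rfl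

/-- **AT THE PRINT-REGIME MEMBER: `ν.εreg ≤ θ.εbg`** (the two-radii letter `εreg ≤ εbg` of N09's roads, with equality). [cite: Balaban1985Variational, Thm 1 (8) p.279; Balaban1987RG1, (0.21) p.256, (1.2) p.260 (bookkeeping)] -/
theorem εreg_le_εbg_theta13OfThm1CCMWZBAx_regime :
    (theta13OfThm1CCMWZBAx F N j γ a₀ ε₀ ε₂₉ B₃ B₃' a₀ a₁ Efl logz).ν.εreg ≤ (theta13OfThm1CCMWZBAx F N j γ a₀ ε₀ ε₂₉ B₃ B₃' a₀ a₁ Efl logz).εbg := le_rfl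

variable {εbg a₀} in
/-- **AT A GENERAL MEMBER: the two regime letters read on the free pair `(a₀, εbg)`** — `ν.εreg ≤ θ.εbg ≤ a₀` iff `a₀ ≤ εbg ≤ a₀`, i.e. exactly at `εbg = a₀`; displayed as the
implication the consumer uses. [cite: Balaban1985Variational, Thm 1 p.279; Balaban1987RG1, (0.21) p.256, (1.2) p.260 (bookkeeping)] -/
theorem regimeLetters_theta13OfThm1CCMWZBAx (h₁ : a₀ ≤ εbg) (h₂ : εbg ≤ a₀) :
    (theta13OfThm1CCMWZBAx F N j γ εbg ε₀ ε₂₉ B₃ B₃' a₀ a₁ Efl logz).ν.εreg ≤ (theta13OfThm1CCMWZBAx F N j γ εbg ε₀ ε₂₉ B₃ B₃' a₀ a₁ Efl logz).εbg ∧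
      (theta13OfThm1CCMWZBAx F N j γ εbg ε₀ ε₂₉ B₃ B₃' a₀ a₁ Efl logz).εbg ≤ a₀ :=
  ⟨h₁, h₂⟩

/-- The re-centred witness IS the χ witness at `chiFixed29Ax F N ν ε₂₉` (`rfl`). [cite: Balaban1987RG1, (2.9) p.266 (bookkeeping)] -/
theorem theta13OfThm1CCMWZBAx_eq_chi :
    theta13OfThm1CCMWZBAx F N j γ εbg ε₀ ε₂₉ B₃ B₃' a₀ a₁ Efl logz =
      theta13OfThm1CCMWZBChi F N j γ εbg ε₀ ε₂₉ B₃ B₃' a₀ a₁ Efl logz (chiFixed29Ax F N (numerics7OfThm1CCM F.L j ε₀ B₃ B₃' a₀ a₁) ε₂₉) := rfl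

/-- … and IS the χ witness at DEF-1's own re-centred slot `chiβOfRecord₁₃Ax θ₁₅ᶜᶜᴹᵂᶻᴮ` (`rfl`). [cite: Balaban1987RG1, (2.9) p.266 (bookkeeping)] -/
theorem theta13OfThm1CCMWZBAx_eq_chi_chiβAx :
    theta13OfThm1CCMWZBAx F N j γ εbg ε₀ ε₂₉ B₃ B₃' a₀ a₁ Efl logz =
      theta13OfThm1CCMWZBChi F N j γ εbg ε₀ ε₂₉ B₃ B₃' a₀ a₁ Efl logz (chiβOfRecord₁₃Ax F N (theta13OfThm1CCMWZB F N j γ εbg ε₀ ε₂₉ B₃ B₃' a₀ a₁ Efl logz)) := rfl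

/-- The re-centred witness keeps its re-centred β-slot: `chiβOfRecord₁₃Ax (θᴬˣ) = chiFixed29Ax F N ν ε₂₉` (`rfl`). [cite: Balaban1987RG1, (2.9) p.266 (bookkeeping)] -/
theorem chiβOfRecord₁₃Ax_theta13OfThm1CCMWZBAx :
    chiβOfRecord₁₃Ax F N (theta13OfThm1CCMWZBAx F N j γ εbg ε₀ ε₂₉ B₃ B₃' a₀ a₁ Efl logz) = chiFixed29Ax F N (numerics7OfThm1CCM F.L j ε₀ B₃ B₃' a₀ a₁) ε₂₉ := rfl

/-- DEF-1's witness's re-centred β-slot in closed form: `chiβOfRecord₁₃Ax (θ₁₅ᶜᶜᴹᵂᶻᴮ) = chiFixed29Ax F N ν ε₂₉` (`rfl`; a NEW name about the landed witness, no body touched).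
[cite: Balaban1987RG1, (2.9) p.266 (bookkeeping)] -/
theorem chiβOfRecord₁₃Ax_theta13OfThm1CCMWZB :
    chiβOfRecord₁₃Ax F N (theta13OfThm1CCMWZB F N j γ εbg ε₀ ε₂₉ B₃ B₃' a₀ a₁ Efl logz) = chiFixed29Ax F N (numerics7OfThm1CCM F.L j ε₀ B₃ B₃' a₀ a₁) ε₂₉ := rfl

/-- … which IS DEF-1's witness's re-centred β-slot (by the two closed forms): the H3.3 consumer may read either. [cite: Balaban1987RG1, (2.9) p.266 (bookkeeping)] -/
theorem chiβOfRecord₁₃Ax_theta13OfThm1CCMWZBAx_eq :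
    chiβOfRecord₁₃Ax F N (theta13OfThm1CCMWZBAx F N j γ εbg ε₀ ε₂₉ B₃ B₃' a₀ a₁ Efl logz) =
      chiβOfRecord₁₃Ax F N (theta13OfThm1CCMWZB F N j γ εbg ε₀ ε₂₉ B₃ B₃' a₀ a₁ Efl logz) :=
  (chiβOfRecord₁₃Ax_theta13OfThm1CCMWZBAx F N j γ εbg ε₀ ε₂₉ B₃ B₃' a₀ a₁ Efl logz).trans
    (chiβOfRecord₁₃Ax_theta13OfThm1CCMWZB F N j γ εbg ε₀ ε₂₉ B₃ B₃' a₀ a₁ Efl logz).symm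

end WitnessZBAx

end Literature.MathematicalPhysics.QuantumFieldTheory.Balaban1983to89.Node00

end
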